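import Mathlib
import Summits.ResolutionOfSingularities.ResolutionOfSingularities.Theorems.WeightedInvariantLocalWeightedDropWildMonicFlagAttainRecentre
import Summits.ResolutionOfSingularities.ResolutionOfSingularities.Theorems.WeightedInvariantLocalWeightedDropWildMonicFlagComplete
import Summits.ResolutionOfSingularities.ResolutionOfSingularities.Theorems.WeightedInvariantLocalWeightedDropWildMonicFlagSettingDict

/-!
# `WeightedInvariant.LocalWeightedDrop`, line `hasse-ridge-face-selection`, S3ρ sub-stub S3ρD `stub_wildMonicSurfaceDescent`: item D-0
# «maximising flag» — `s` IS ATTAINED OVER THE SETTING-PRESERVING RE-CENTRINGS (Per17 Prop. 5.3.5, plane flag fixed — UNCONDITIONAL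
# up to the maximality of the setting)

Crux item stmt-ResolutionOfSingularities-8899 `LocalWeightedDrop` (route `ResolutionOfSingularities/WeightedInvariant`), engine of the door
`HypersurfaceCentreConstruction` stmt-ResolutionOfSingularities-19897.  [OURS · L1 W4.3, chain w43, res-L1-w43-stub-3 (gen 3) on roadmap item
D-0 of `L/res-L1-w43-stub-7/S3RHOD-ROADMAP.md` (owners res-type-083 / stub-7); spec `L/res-L1-w43-stub-3/D0-SPEC.md` §8 (D-0d (α)).  MODEL:
Perlega, arXiv:2011.14443 Ch. 5 Prop. 5.3.5 `maximum_over_y_and_z_exists` restricted to `z ↦ z + g` (and §5.2 Prop. 5.2.6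
`s_cleaning_terminates`, whose non-terminating branch is the same limit).  ASSEMBLY of `exists_isGreatest_sFlag_shift_of_complete`
(`…FlagAttainRecentre`: stub-5's kernel + stub-7's Lemma 5.2.2) with the completeness of the setting class (`exists_limit_mem_wMinClass`,
`…FlagComplete`) through the dictionary `…FlagSettingDict`.  Definition-free.]

* **`exists_isGreatest_sFlag_shift`** — for a base tuple `B` (`0 < d`), boundary `E` and a setting `(δ₀ > 0, r₀)` such that
  (`hnz`) no re-centring annihilates the tuple, and (`hmax`) no re-centring dominates the setting (`r ≥ r₀` on `E` and
  `dRes + |r| ≥ δ₀ + |r₀|` force equality — in D-0: `r₀` the maximal exceptional exponents, `δ₀` the top class `D`): if the class of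
  setting-preserving re-centrings is non-empty and `sFlag` is finite on it, then `sFlag` ATTAINS ITS MAXIMUM on the class.
-/

set_option linter.dupNamespace false -- mandated namespace of this single-conjunct summit

namespace Summit.ResolutionOfSingularities.ResolutionOfSingularities.Theorems

namespace WildMonic

open MvPowerSeries

variable {k : Type} [Field k] {d : ℕ}

/-- **PER17 PROP. 5.3.5 FOR RE-CENTRINGS, plane flag fixed** — `s = sFlag` attains its maximum over the re-centrings `y ↦ y + g`,
`g(0) = 0`, preserving the setting `(dRes, excExp) = (δ₀, r₀)`, provided `δ₀ > 0`, no re-centring annihilates the tuple (`hnz`, else the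
position is an exit), no re-centring dominates the setting (`hmax`), the class is non-empty and `sFlag` is finite on it (else an exit).
[cite: Perlega2020, Prop. 5.3.5 and Prop. 5.2.6 (arXiv:2011.14443 Ch. 5 §2 p0061–p0062, §3 p0066 L60 – p0067 L40)] -/
theorem exists_isGreatest_sFlag_shift (hd : 0 < d) (E : Finset (Fin 2)) (B : Fin d → MvPowerSeries (Fin 2) k)
    (δ₀ : ℕ) (hδ₀ : 0 < δ₀) (r₀ : Fin 2 →₀ ℕ)
    (hnz : ∀ g : MvPowerSeries (Fin 2) k, constantCoeff g = 0 → (newtonSet (shift d B g)).Nonempty)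
    (hmax : ∀ g : MvPowerSeries (Fin 2) k, constantCoeff g = 0 →
      (∀ i ∈ E, r₀ i ≤ excExp E (newtonSet (shift d B g)) i) →
      δ₀ + r₀ 0 + r₀ 1 ≤ dRes E (newtonSet (shift d B g)) + excExp E (newtonSet (shift d B g)) 0 +
        excExp E (newtonSet (shift d B g)) 1 →
      dRes E (newtonSet (shift d B g)) = δ₀ ∧ excExp E (newtonSet (shift d B g)) = r₀)
    (hne : ∃ g : MvPowerSeries (Fin 2) k, constantCoeff g = 0 ∧ dRes E (newtonSet (shift d B g)) = δ₀ ∧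
      excExp E (newtonSet (shift d B g)) = r₀)
    (hfin : ∀ g : MvPowerSeries (Fin 2) k, constantCoeff g = 0 → dRes E (newtonSet (shift d B g)) = δ₀ →
      excExp E (newtonSet (shift d B g)) = r₀ → sFlag E (newtonSet (shift d B g)) ≠ ⊤) :
    ∃ g : MvPowerSeries (Fin 2) k, constantCoeff g = 0 ∧ dRes E (newtonSet (shift d B g)) = δ₀ ∧
      excExp E (newtonSet (shift d B g)) = r₀ ∧ sFlag E (newtonSet (shift d B g)) ≠ ⊤ ∧
      ∀ g' : MvPowerSeries (Fin 2) k, constantCoeff g' = 0 → dRes E (newtonSet (shift d B g')) = δ₀ →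
        excExp E (newtonSet (shift d B g')) = r₀ → sFlag E (newtonSet (shift d B g')) ≤ sFlag E (newtonSet (shift d B g)) := by
  obtain ⟨g₀, hg₀0, hg₀δ, hg₀r⟩ := hne
  -- `r₀` vanishes off the boundary
  have hr₀E : ∀ i, i ∉ E → r₀ i = 0 := by
    intro i hi
    rw [← hg₀r]
    have hi2 : i = 0 ∨ i = 1 := by fin_cases i <;> simp
    rcases hi2 with rfl | rfl
    · rw [excExp_apply_zero, if_neg hi]
    · rw [excExp_apply_one, if_neg hi]
  -- the setting as weighted orders: the weights the boundary sees, and `(1,1)`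
  let W : Set (Fin 2 → ℕ) := {w | w = ![1, 1] ∨ ((0 : Fin 2) ∈ E ∧ w = ![1, 0]) ∨ ((1 : Fin 2) ∈ E ∧ w = ![0, 1])}
  let m : (Fin 2 → ℕ) → ℕ∞ := fun w => wMin w (shift d B g₀)
  have h0 := wMin_eq_of_newtonSet_nonempty E (shift d B g₀) (hnz g₀ hg₀0)
  rw [hg₀δ, hg₀r] at h0
  -- membership in the `(dRes, excExp)`-class ⟺ membership in the `wMin`-class
  have hGW : ∀ g : MvPowerSeries (Fin 2) k, constantCoeff g = 0 →
      (dRes E (newtonSet (shift d B g)) = δ₀ ∧ excExp E (newtonSet (shift d B g)) = r₀ ↔ ∀ w ∈ W, wMin w (shift d B g) = m w) := by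
    intro g hg
    have h1 := wMin_eq_of_newtonSet_nonempty E (shift d B g) (hnz g hg)
    constructor
    · rintro ⟨hδ, hr⟩
      rw [hδ, hr] at h1
      rintro w (rfl | ⟨hE, rfl⟩ | ⟨hE, rfl⟩)
      · show wMin ![1, 1] (shift d B g) = wMin ![1, 1] (shift d B g₀)
        rw [h1.1, h0.1]
      · show wMin ![1, 0] (shift d B g) = wMin ![1, 0] (shift d B g₀)
        rw [h1.2.1 hE, h0.2.1 hE]
      · show wMin ![0, 1] (shift d B g) = wMin ![0, 1] (shift d B g₀)
        rw [h1.2.2 hE, h0.2.2 hE]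
    · intro hw
      have h11 : wMin ![1, 1] (shift d B g) = wMin ![1, 1] (shift d B g₀) := hw _ (Or.inl rfl)
      have h10 : (0 : Fin 2) ∈ E → wMin ![1, 0] (shift d B g) = wMin ![1, 0] (shift d B g₀) :=
        fun hE => hw _ (Or.inr (Or.inl ⟨hE, rfl⟩))
      have h01 : (1 : Fin 2) ∈ E → wMin ![0, 1] (shift d B g) = wMin ![0, 1] (shift d B g₀) :=
        fun hE => hw _ (Or.inr (Or.inr ⟨hE, rfl⟩))
      exact ⟨(dRes_eq_of_wMin_eq E h10 h01 h11).trans hg₀δ, (excExp_eq_of_wMin_eq E h10 h01).trans hg₀r⟩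
  -- no re-centring dominates the `wMin`-class values
  have hmaxW : ∀ g : MvPowerSeries (Fin 2) k, constantCoeff g = 0 → (∀ w ∈ W, m w ≤ wMin w (shift d B g)) →
      ∀ w ∈ W, wMin w (shift d B g) ≤ m w := by
    intro g hg hge
    have h1 := wMin_eq_of_newtonSet_nonempty E (shift d B g) (hnz g hg)
    have hr : ∀ i ∈ E, r₀ i ≤ excExp E (newtonSet (shift d B g)) i := by
      intro i hi
      have hi2 : i = 0 ∨ i = 1 := by fin_cases i <;> simp
      rcases hi2 with rfl | rfl
      · have h2 := hge _ (Or.inr (Or.inl ⟨hi, rfl⟩))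
        change wMin ![1, 0] (shift d B g₀) ≤ wMin ![1, 0] (shift d B g) at h2
        rw [h0.2.1 hi, h1.2.1 hi, Nat.cast_le] at h2
        exact h2
      · have h2 := hge _ (Or.inr (Or.inr ⟨hi, rfl⟩))
        change wMin ![0, 1] (shift d B g₀) ≤ wMin ![0, 1] (shift d B g) at h2
        rw [h0.2.2 hi, h1.2.2 hi, Nat.cast_le] at h2
        exact h2
    have hδ : δ₀ + r₀ 0 + r₀ 1 ≤ dRes E (newtonSet (shift d B g)) + excExp E (newtonSet (shift d B g)) 0 +
        excExp E (newtonSet (shift d B g)) 1 := by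
      have h2 := hge _ (Or.inl rfl)
      change wMin ![1, 1] (shift d B g₀) ≤ wMin ![1, 1] (shift d B g) at h2
      rw [h0.1, h1.1, Nat.cast_le] at h2
      exact h2
    have heq := (hGW g hg).1 (hmax g hg hr hδ)
    exact fun w hw => (heq w hw).le
  have hpos : ∃ w ∈ W, 0 < m w := by
    refine ⟨![1, 1], Or.inl rfl, ?_⟩
    change 0 < wMin ![1, 1] (shift d B g₀)
    rw [h0.1]
    exact_mod_cast (by omega : 0 < δ₀ + r₀ 0 + r₀ 1)
  -- the kernel, with completeness supplied
  refine exists_isGreatest_sFlag_shift_of_complete hd E B δ₀ r₀ ⟨g₀, hg₀0, hg₀δ, hg₀r⟩ hfin ?_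
  intro c N hN hc hlines
  obtain ⟨b, hb0, hbW, hblines⟩ := exists_limit_mem_wMinClass hd B W m δ₀ r₀ hpos hmaxW c N hN
    (fun j => ⟨(hc j).1, ((hGW (c j) (hc j).1).1 ⟨(hc j).2.1, (hc j).2.2.1⟩)⟩) hlines
  obtain ⟨hbδ, hbr⟩ := (hGW b hb0).2 hbW
  exact ⟨b, hb0, hbδ, hbr, hblines⟩

end WildMonic

end Summit.ResolutionOfSingularities.ResolutionOfSingularities.Theorems
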